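import Mathlib

/-!
# The one-slope-floor state of Hauser's tree is a cusp-cylinder (crux `WeightedConstruction`, chain w43, seat tri-1 — TRIAGE v9 §21.3)

[OURS · L1 W4.3 · stmt-ResolutionOfSingularities-0571 (bears on the DOOR item stmt-ResolutionOfSingularities-19897,
rung P3) · NEGATIVE-lane helper lemmas: pure polynomial identities, no Theses statement is asserted, no Hironaka-type
statement is used as a premise; AI-written, weaker than expert review.]

Companion to `KangarooDischargeIdentities` / `KDegenIdentities`.  res-type-078's FINDING (2026-08-27T10:53:25Z, (E1))
reports, for the pair `ι = (iotaOrd, bMax)` with the one-slope FLOOR centre, a rise `(2,1) → (2,2)` inside the P3 rung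
on Hauser's tree `x² + y⁷ + yz⁴ / 𝔽₂`, starting at the Krull-dimension-3 position `𝔫 = (x′, T, z′)` (`ȳ` generic) of
the depth-1 state `g = x′² + T(1+ȳ)z′⁴ + T³(1+ȳ)⁷`.  The identities below certify TRIAGE v9's re-reading:

* `kangaroo_T_unit_chart_cusp` (K2′, characteristic 2): wherever the handle parameter `T` of the kangaroo germ
  `𝔨 = X² + wA⁴ + w³T⁴` is a unit, `T²·𝔨 = (TX + A·M)² + M³` with `M := A² + wT²` — a CUSP-CYLINDER `x̃² + M³`
  (value (2,3)) at EVERY point of `V(x̃, M)`; this sharpens the informal gloss of `KDegenIdentities.kangaroo_T_unit_chart`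
  («(2,3,6) at A = 0, double line elsewhere»): in characteristic 2 the `A²M²` term is absorbed into the square
  (`doubleLine_absorb_eq_cusp`).
* `floorState_eq_kangaroo` (characteristic-free): 078's state IS the kangaroo germ, `g = 𝔨(x′, T(1+ȳ), z′, 1+ȳ)`.
* `floorState_eq_cuspCylinder` (characteristic 2): `(1+ȳ)²·g = ((1+ȳ)x′ + z′M)² + M³`, `M = z′² + T(1+ȳ)³`; so at `𝔫`
  (where `1+ȳ` is a unit and `x̃ = (1+ȳ)x′ + z′M`, `M` are regular parameters) the position is the cusp-cylinder, its
  singular locus / equal-`(2,1)` stratum is the regular SURFACE `V(x̃, M)` (codimension 2 in `B_𝔫`), not the `ȳ`-line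
  `V(x′,T,z′)`, and the (o28) cylinder along `V(x̃, M)` resolves it (`cuspCylinder_chart_M`, `cuspCylinder_chart_x`:
  strict transforms `x₁² + M` (regular) and a unit).  The reported rise is produced by the centre `V(x′,T,z′)` — the
  minimal COORDINATE subset of the engine frame — whose `[T:z′] = [0:1]` chart is `floorState_lineBlowup_chart`
  (characteristic-free) with the characteristic-2 normal form `lineBlowup_successor_eq` = `x‴² + u·T″·N³`
  (`bMax = 2`): a frame artefact of the same species as pub-rosobs-eng1-g60's class (b2), not a P3-internal failure of
  the floor pair read frame-free.

Characteristic 2 enters only as the hypothesis `(2 : R) = 0`; the other identities hold in every commutative ring.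
-/

namespace Summit.ResolutionOfSingularities.ResolutionOfSingularities.Theorems.WeightedConstruction.Negative.FloorStateCuspIdentities

/-- (ABS) Characteristic-2 square absorption: `x² + M²(M + A²) = (x + AM)² + M³`.  So the «double line» gloss of
`kangaroo_T_unit_chart` is a cusp-cylinder everywhere on `V(x, M)`. [OURS · derived here] -/
theorem doubleLine_absorb_eq_cusp {R : Type*} [CommRing R] (h2 : (2 : R) = 0) (x M A : R) :
    x ^ 2 + M ^ 2 * (M + A ^ 2) = (x + A * M) ^ 2 + M ^ 3 := by
  linear_combination (-(x * A * M)) * h2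

/-- (K2′) Kangaroo germ in its `T`-unit chart, absorbed form (characteristic 2):
`T²·(X² + wA⁴ + w³T⁴) = (TX + A(A² + wT²))² + (A² + wT²)³`. [OURS · derived here] -/
theorem kangaroo_T_unit_chart_cusp {R : Type*} [CommRing R] (h2 : (2 : R) = 0) (X w A T : R) :
    T ^ 2 * (X ^ 2 + w * A ^ 4 + w ^ 3 * T ^ 4) =
      (T * X + A * (A ^ 2 + w * T ^ 2)) ^ 2 + (A ^ 2 + w * T ^ 2) ^ 3 := by
  linear_combination (-(T * X * A * (A ^ 2 + w * T ^ 2) + A ^ 2 * (A ^ 2 + w * T ^ 2) ^ 2 + w ^ 2 * A ^ 2 * T ^ 4)) * h2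

/-- (E1-0) res-type-078's depth-1 floor state of Hauser's tree IS the kangaroo germ (characteristic-free):
`x′² + T(1+ȳ)z′⁴ + T³(1+ȳ)⁷ = 𝔨(x′, w := T(1+ȳ), A := z′, T := 1+ȳ)`. [OURS · derived here] -/
theorem floorState_eq_kangaroo {R : Type*} [CommRing R] (x T z y : R) :
    x ^ 2 + T * (1 + y) * z ^ 4 + T ^ 3 * (1 + y) ^ 7 =
      x ^ 2 + (T * (1 + y)) * z ^ 4 + (T * (1 + y)) ^ 3 * (1 + y) ^ 4 := by
  ring

/-- (E1-1) The floor state is a cusp-cylinder where `1+ȳ` is a unit (characteristic 2):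
`(1+ȳ)²·g = ((1+ȳ)x′ + z′M)² + M³` with `M = z′² + T(1+ȳ)³`. [OURS · derived here] -/
theorem floorState_eq_cuspCylinder {R : Type*} [CommRing R] (h2 : (2 : R) = 0) (x T z y : R) :
    (1 + y) ^ 2 * (x ^ 2 + T * (1 + y) * z ^ 4 + T ^ 3 * (1 + y) ^ 7) =
      ((1 + y) * x + z * (z ^ 2 + T * (1 + y) ^ 3)) ^ 2 + (z ^ 2 + T * (1 + y) ^ 3) ^ 3 := by
  linear_combination (-((1 + y) * x * z * (z ^ 2 + T * (1 + y) ^ 3) + z ^ 2 * (z ^ 2 + T * (1 + y) ^ 3) ^ 2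
    + (T * (1 + y)) ^ 2 * z ^ 2 * (1 + y) ^ 4)) * h2

/-- (CYL-M) Cylinder blow-up of the cusp-cylinder `x̃² + M³` along `V(x̃, M)`, chart `x̃ = x₁·M`: total transform
`M²·(x₁² + M)`, strict transform `x₁² + M` — regular (`M` is a parameter). Characteristic-free. [OURS · derived here] -/
theorem cuspCylinder_chart_M {R : Type*} [CommRing R] (x₁ M : R) :
    (x₁ * M) ^ 2 + M ^ 3 = M ^ 2 * (x₁ ^ 2 + M) := by
  ring

/-- (CYL-x) Same blow-up, chart `M = m₁·x̃`: total transform `x̃²·(1 + m₁³x̃)`, strict transform a unit.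
Characteristic-free. [OURS · derived here] -/
theorem cuspCylinder_chart_x {R : Type*} [CommRing R] (x m₁ : R) :
    x ^ 2 + (m₁ * x) ^ 3 = x ^ 2 * (1 + m₁ ^ 3 * x) := by
  ring

/-- (LINE) The engine's move instead: blow-up of the COORDINATE line `V(x′, T, z′)` (weights (1,1,1)), chart
`[T : z′] = [0 : 1]`, i.e. `z′ = σ`, `T = σT″`, `x′ = σx″` (with `u := 1+ȳ`): total transform
`σ²·(x″² + σ³T″u + σT″³u⁷)` — res-type-078's successor `G`. Characteristic-free. [OURS · derived here] -/
theorem floorState_lineBlowup_chart {R : Type*} [CommRing R] (x'' T'' σ u : R) :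
    (σ * x'') ^ 2 + (σ * T'') * u * σ ^ 4 + (σ * T'') ^ 3 * u ^ 7 =
      σ ^ 2 * (x'' ^ 2 + σ ^ 3 * T'' * u + σ * T'' ^ 3 * u ^ 7) := by
  ring

/-- (LINE′) Characteristic-2 normal form of that successor: with `N := σ + T″u³`,
`G = x″² + σ³T″u + σT″³u⁷ = (x″ + u²T″N)² + u·T″·N³` up to `2 = 0` — an `x² + zy³`-type point with `bMax = 2`
(weights (2,1,1), degree 4), whence the engine's rise `(2,1) → (2,2)`. [OURS · derived here] -/
theorem lineBlowup_successor_eq {R : Type*} [CommRing R] (h2 : (2 : R) = 0) (x'' T'' σ u : R) :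
    x'' ^ 2 + σ ^ 3 * T'' * u + σ * T'' ^ 3 * u ^ 7 =
      (x'' + u ^ 2 * T'' * (σ + T'' * u ^ 3)) ^ 2 + u * T'' * (σ + T'' * u ^ 3) ^ 3 := by
  linear_combination (-(x'' * u ^ 2 * T'' * (σ + T'' * u ^ 3) + u ^ 4 * T'' ^ 2 * (σ + T'' * u ^ 3) ^ 2
    + u ^ 4 * T'' ^ 2 * σ ^ 2)) * h2

end Summit.ResolutionOfSingularities.ResolutionOfSingularities.Theorems.WeightedConstruction.Negative.FloorStateCuspIdentities
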